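import Summits.Ventures.PercRepro.C041PortProblemCaseVSum

/-!
# The port problem of THEOREM R: the terminal swap `1 ↔ 2` (p6, gen 23)

Setting of `C041PortProblemDefs`.  Exchanging the two terminals (`k₁ ↔ k₂`, the 1-edges becoming 2-edges) gives a
port problem `P.swap` with the same graph, root, ports, gates and sub-problems; the patterns correspond by
`e ↦ (e.1.1, !e.1.2)` (`swapPattern`), `A₁ ↔ A₂`, `X₁ ↔ X₂`, `Good₁ ↔ Good₂`, the weights agree, and so do the
sums (`phiOr_swap`, `phiAnd_swap`).  This turns the type-`{1}` statements of case (v) into their type-`{2}` mirrors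
(`phiOr_sub_le'`, `phiAnd_sub_le'`) without repeating the proofs.
-/

namespace PercRepro

namespace PortProblem

namespace Problem

open Finset

variable {V : Type*}

/-- The problem with the two terminals exchanged. -/
def swap (P : Problem V) : Problem V :=
  { P with k₁ := P.k₂, k₂ := P.k₁, hk := fun p hp => (P.hk p hp).symm }

variable {P : Problem V}

/-- The swap keeps the graph. -/
@[simp] theorem swap_adj (a b : V) : P.swap.adj a b = P.adj a b := rfl
/-- The swap keeps the root. -/
@[simp] theorem swap_c : P.swap.c = P.c := rfl
/-- The swap keeps the ports. -/
@[simp] theorem swap_M : P.swap.M = P.M := rfl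
/-- The swap exchanges the terminal flags. -/
@[simp] theorem swap_k₁ (p : V) : P.swap.k₁ p = P.k₂ p := rfl
/-- The swap exchanges the terminal flags. -/
@[simp] theorem swap_k₂ (p : V) : P.swap.k₂ p = P.k₁ p := rfl
/-- The swap keeps the switchability. -/
@[simp] theorem swap_sw (p : V) : P.swap.sw p = P.sw p := rfl

/-- The terms correspond by flipping the side. -/
def swapTerm (P : Problem V) : P.Term ≃ P.swap.Term where
  toFun e := ⟨(e.1.1, !e.1.2), e.2.1,
    fun h => e.2.2.2 (by cases h' : e.1.2 <;> simp_all),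
    fun h => e.2.2.1 (by cases h' : e.1.2 <;> simp_all)⟩
  invFun e := ⟨(e.1.1, !e.1.2), e.2.1,
    fun h => e.2.2.2 (by cases h' : e.1.2 <;> simp_all),
    fun h => e.2.2.1 (by cases h' : e.1.2 <;> simp_all)⟩
  left_inv e := Subtype.ext (Prod.ext rfl (Bool.not_not _))
  right_inv e := Subtype.ext (Prod.ext rfl (Bool.not_not _))

/-- The pattern correspondence. -/
def swapPattern (P : Problem V) (x : P.Term → Bool) : P.swap.Term → Bool :=
  fun e => x ((swapTerm P).symm e)

/-- The swapped pattern at a swapped term. -/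
theorem swapPattern_apply (x : P.Term → Bool) (e : P.Term) : P.swapPattern x (swapTerm P e) = x e := by
  unfold swapPattern
  rw [Equiv.symm_apply_apply]

/-- Reachability is the same in the swapped problem. -/
theorem reach_swap (A : Set V) (u v : V) : P.swap.Reach A u v ↔ P.Reach A u v := Iff.rfl

/-- The gates are the same. -/
theorem isGate_swap (p : V) : P.swap.IsGate p ↔ P.IsGate p := Iff.rfl

/-- `A₁` of the swap is `A₂`. -/
theorem A₁_swap (x : P.Term → Bool) : P.swap.A₁ (P.swapPattern x) = P.A₂ x := by
  ext q
  constructor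
  · rintro ⟨e, he, hxe⟩
    refine ⟨(swapTerm P).symm e, ?_, hxe⟩
    show ((e.1.1, !e.1.2) : V × Bool) = (q, true)
    rw [he]
    rfl
  · rintro ⟨e, he, hxe⟩
    refine ⟨swapTerm P e, ?_, by rw [swapPattern_apply]; exact hxe⟩
    show ((e.1.1, !e.1.2) : V × Bool) = (q, false)
    rw [he]
    rfl

/-- `A₂` of the swap is `A₁`. -/
theorem A₂_swap (x : P.Term → Bool) : P.swap.A₂ (P.swapPattern x) = P.A₁ x := by
  ext q
  constructor
  · rintro ⟨e, he, hxe⟩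
    refine ⟨(swapTerm P).symm e, ?_, hxe⟩
    show ((e.1.1, !e.1.2) : V × Bool) = (q, false)
    rw [he]
    rfl
  · rintro ⟨e, he, hxe⟩
    refine ⟨swapTerm P e, ?_, by rw [swapPattern_apply]; exact hxe⟩
    show ((e.1.1, !e.1.2) : V × Bool) = (q, true)
    rw [he]
    rfl

/-- `X₁` of the swap is `X₂`. -/
theorem X₁_swap (x : P.Term → Bool) : P.swap.X₁ (P.swapPattern x) ↔ P.X₂ x := by
  constructor
  · rintro ⟨e, he, hxe⟩
    refine ⟨(swapTerm P).symm e, ?_, hxe⟩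
    show (!e.1.2) = true
    rw [he]
    rfl
  · rintro ⟨e, he, hxe⟩
    refine ⟨swapTerm P e, ?_, by rw [swapPattern_apply]; exact hxe⟩
    show (!e.1.2) = false
    rw [he]
    rfl

/-- `X₂` of the swap is `X₁`. -/
theorem X₂_swap (x : P.Term → Bool) : P.swap.X₂ (P.swapPattern x) ↔ P.X₁ x := by
  constructor
  · rintro ⟨e, he, hxe⟩
    refine ⟨(swapTerm P).symm e, ?_, hxe⟩
    show (!e.1.2) = false
    rw [he]
    rfl
  · rintro ⟨e, he, hxe⟩
    refine ⟨swapTerm P e, ?_, by rw [swapPattern_apply]; exact hxe⟩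
    show (!e.1.2) = true
    rw [he]
    rfl

/-- `Good₁` of the swap is `Good₂`. -/
theorem good₁_swap (x : P.Term → Bool) : P.swap.Good₁ (P.swapPattern x) ↔ P.Good₂ x := by
  unfold Good₁ Good₂
  rw [A₁_swap]
  constructor
  · rintro ⟨e, he, hxe, hr⟩
    refine ⟨(swapTerm P).symm e, ?_, hxe, hr⟩
    show (!e.1.2) = false
    rw [he]
    rfl
  · rintro ⟨e, he, hxe, hr⟩
    refine ⟨swapTerm P e, ?_, by rw [swapPattern_apply]; exact hxe, hr⟩
    show (!e.1.2) = true
    rw [he]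
    rfl

/-- `Good₂` of the swap is `Good₁`. -/
theorem good₂_swap (x : P.Term → Bool) : P.swap.Good₂ (P.swapPattern x) ↔ P.Good₁ x := by
  unfold Good₁ Good₂
  rw [A₂_swap]
  constructor
  · rintro ⟨e, he, hxe, hr⟩
    refine ⟨(swapTerm P).symm e, ?_, hxe, hr⟩
    show (!e.1.2) = true
    rw [he]
    rfl
  · rintro ⟨e, he, hxe, hr⟩
    refine ⟨swapTerm P e, ?_, by rw [swapPattern_apply]; exact hxe, hr⟩
    show (!e.1.2) = false
    rw [he]
    rfl

/-- Admissibility is symmetric. -/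
theorem adm_swap (x : P.Term → Bool) : P.swap.Adm (P.swapPattern x) ↔ P.Adm x := by
  constructor
  · rintro ⟨h1, h2⟩
    refine ⟨fun e he => ?_, fun e f hef he hf => ?_⟩
    · have := h1 (swapTerm P e) he
      rw [swapPattern_apply] at this
      exact this
    · -- `f` (a 2-edge) and `e` (a 1-edge) swap roles
      have := h2 (swapTerm P f) (swapTerm P e) hef.symm (by show (!f.1.2) = false; rw [hf]; rfl)
        (by show (!e.1.2) = true; rw [he]; rfl)
      rw [swapPattern_apply, swapPattern_apply] at this
      exact this.symm
  · rintro ⟨h1, h2⟩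
    refine ⟨fun e he => ?_, fun e f hef he hf => ?_⟩
    · have := h1 ((swapTerm P).symm e) he
      unfold swapPattern
      exact this
    · have := h2 ((swapTerm P).symm f) ((swapTerm P).symm e) hef.symm
        (by show (!f.1.2) = false; rw [hf]; rfl) (by show (!e.1.2) = true; rw [he]; rfl)
      unfold swapPattern
      exact this.symm

open Classical in
/-- The weight is symmetric. -/
theorem weight_swap (x : P.Term → Bool) : P.swap.weight (P.swapPattern x) = P.weight x := by
  unfold weight
  rw [if_congr (good₁_swap x) rfl rfl, if_congr (good₂_swap x) rfl rfl]
  ring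

/-- The pattern correspondence as an equivalence. -/
def swapPatternEquiv (P : Problem V) : (P.Term → Bool) ≃ (P.swap.Term → Bool) :=
  (swapTerm P).arrowCongr (Equiv.refl Bool)

/-- The equivalence is the pattern correspondence. -/
theorem swapPatternEquiv_apply (x : P.Term → Bool) : P.swapPatternEquiv x = P.swapPattern x := by
  funext e
  simp only [swapPatternEquiv, Equiv.arrowCongr_apply, Function.comp, Equiv.refl_apply]
  rfl

section SubSwap

variable [DecidableEq V]

/-- The sub-problem of the swap is the swap of the sub-problem. -/
theorem swap_sub (p : V) : P.swap.sub p = (P.sub p).swap := rfl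

end SubSwap

section Sums

variable [Fintype V] [DecidableEq V]

open Classical in
/-- `Φ∨` is symmetric in the terminals. -/
theorem phiOr_swap : P.swap.phiOr = P.phiOr := by
  unfold phiOr
  rw [← (P.swapPatternEquiv).sum_comp]
  apply Finset.sum_congr rfl
  intro x _
  rw [swapPatternEquiv_apply, weight_swap]
  by_cases h : P.Adm x ∧ (P.X₁ x ∨ P.X₂ x)
  · rw [if_pos h, if_pos ⟨(adm_swap x).2 h.1, h.2.elim (fun h' => Or.inr ((X₂_swap x).2 h'))
      (fun h' => Or.inl ((X₁_swap x).2 h'))⟩]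
  · rw [if_neg h, if_neg (fun h' => h ⟨(adm_swap x).1 h'.1, h'.2.elim
      (fun h'' => Or.inr ((X₁_swap x).1 h'')) (fun h'' => Or.inl ((X₂_swap x).1 h''))⟩)]

open Classical in
/-- `Φ∧` is symmetric in the terminals. -/
theorem phiAnd_swap : P.swap.phiAnd = P.phiAnd := by
  unfold phiAnd
  rw [← (P.swapPatternEquiv).sum_comp]
  apply Finset.sum_congr rfl
  intro x _
  rw [swapPatternEquiv_apply, weight_swap]
  by_cases h : P.Adm x ∧ (P.X₁ x ∧ P.X₂ x)
  · rw [if_pos h, if_pos ⟨(adm_swap x).2 h.1, (X₁_swap x).2 h.2.2, (X₂_swap x).2 h.2.1⟩]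
  · rw [if_neg h, if_neg (fun h' => h ⟨(adm_swap x).1 h'.1, (X₂_swap x).1 h'.2.2, (X₁_swap x).1 h'.2.1⟩)]

variable {p : V}

open Classical in
/-- **CASE (v), `Φ∨`, a unique switchable gate of type `{2}`**: `Φ∨ (P.sub p) ≤ Φ∨ P`. -/
theorem phiOr_sub_le' (hp : P.IsGate p) (huniq : ∀ g, P.IsGate g → g = p) (hk₂ : P.k₂ p = true)
    (hk₁ : P.k₁ p = false) (hsw : P.sw p = true) : (P.sub p).phiOr ≤ P.phiOr := by
  have h := phiOr_sub_le (P := P.swap) ((isGate_swap p).2 hp)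
    (fun g hg => huniq g ((isGate_swap g).1 hg)) hk₂ hk₁ hsw
  rw [swap_sub, phiOr_swap, phiOr_swap] at h
  exact h

open Classical in
/-- **CASE (v), `Φ∧`, a unique switchable gate of type `{2}`**: `Φ∧ (P.sub p) ≤ Φ∧ P`. -/
theorem phiAnd_sub_le' (hp : P.IsGate p) (huniq : ∀ g, P.IsGate g → g = p) (hk₂ : P.k₂ p = true)
    (hk₁ : P.k₁ p = false) (hsw : P.sw p = true) : (P.sub p).phiAnd ≤ P.phiAnd := by
  have h := phiAnd_sub_le (P := P.swap) ((isGate_swap p).2 hp)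
    (fun g hg => huniq g ((isGate_swap g).1 hg)) hk₂ hk₁ hsw
  rw [swap_sub, phiAnd_swap, phiAnd_swap] at h
  exact h

end Sums

end Problem

end PortProblem

end PercRepro
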